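import Literature.NumberTheory.Irrationality.FischlerSprangZudilin2019.Lemma3LogSums
import Mathlib.Analysis.SpecialFunctions.Log.Deriv
import Mathlib.Analysis.Complex.ExponentialBounds
import Mathlib.Topology.Order.IntermediateValue
import HarnessLib

/-!
# Fischler–Sprang–Zudilin 2019, §4 Lemma 3 — part 2: the function `f`, the root `x₀`, the profile `L`,
# and the bound `g(x₀) < 3^{-(s+1)}`

Topic `Literature/NumberTheory/Irrationality/FischlerSprangZudilin2019`, namespace
`Literature.NumberTheory.Irrationality.FischlerSprangZudilin2019.Lemma3`. Source: S. Fischler, J. Sprang,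
W. Zudilin, *Many odd zeta values are irrational*, Compositio Math. **155** (2019) 938–952 = arXiv:1803.08905
[FischlerSprangZudilin2019], §4 proof of Lemma 3 (held: `paper:arxiv-1803.08905`, arXiv text pp. 7–8, read on
the page). Second of four files PROVING the tree's named fact `lemma3` (`Asymptotics.lean`); everything here is
proved, no named facts.

## The source, verbatim (the steps formalised here)
"`f(x) = ((x+3)/x)^D ((x+1)/(x+2))^{s+1}`. For the logarithmic derivative of this function we have
`f'(x)/f(x) = D/(x+3) - D/x + (s+1)/(x+1) - (s+1)/(x+2) = (ax²+bx+c)/(x(x+1)(x+2)(x+3))` with `a = s+1-3D > 0`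
and `c = -6D < 0`, hence the derivative `f'(x)` vanishes exactly at one positive real number `x₁`. This means
that the function `f(x)` decreases on `(0, x₁]` and increases on `[x₁,+∞)`. Since `lim_{x→0⁺} f(x) = +∞` and
`lim_{x→+∞} f(x) = 1`, we deduce that there exists a unique positive real number `x₀` such that `f(x₀) = 1`."
… "`c_{k₀(n),j}^{1/n} ∼ … = g(x₀) f(x₀)^{x₀} = g(x₀)`." … "To estimate `g(x₀)` from above, we first show that
`x₀ < a`, where `a = 4 · 2^{-(s+1)/D}`. Observe that `a < ½`, since `s/D ≥ 3`. For any `x > 0` we have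
`(x+1)/(x+2) ≤ ½(1 + x/2)` implying `f(a) ≤ (7/8)^D (1 + a/2)^{s+1}`. As `s/D` is large and `log(7/8) < -1/10`,
we deduce that `f(a)^{1/(s+1)} ≤ (7/8)^{D/(s+1)}(1 + a/2) < (1 - (1/10)D/(s+1))(1 + 2^{1-(s+1)/D}) < 1`, so
that we indeed have `x₀ < a < ½`. Now this upper bound for `x₀` implies
`log g(x₀) ≤ 3D log D + 3D log(7/2) + (s+1)(log(a+1) - 2 log(a+2))`. By taking `s/(D log D)` sufficiently
large, we may ensure that the first two terms are sufficiently small in comparison with `s` and that `a` is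
sufficiently close to `0`, so that `log g(x₀) < -(s+1) log 3`."

## What is proved here
* Part A (structure of `f`): `phi = log f`, its derivative `q(x)/(x(x+1)(x+2)(x+3))` with
  `q(x) = a x² + 3a x - 6D` (the printed `b` is `3(s+1) - 9D = 3a`), the critical point `x₁`, `f → 1` at
  `+∞`, and **`exists_root`**: a positive `x₀` with `f(x₀) = 1`, `f > 1` on `(0, x₀)`, `f < 1` on `(x₀, ∞)`
  (hence the unique positive root of `rootPoly`, `root_unique`).
* Part B (the profile): `Lprof_eq : L(x) = log g(x) + x log f(x)`, `hasDerivAt_Lprof : L' = log f`,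
  `L` strictly increasing on `[0, x₀]` and strictly decreasing on `[x₀, ∞)` (so `L ≤ L(x₀) = log g(x₀)`).
* Part E (the bound): **`gRate_root_lt`**: for `D ≥ 2`, `3D ≤ s` and `100 · D log D ≤ s` (our explicit reading
  of "`s/(D log D)` sufficiently large"), `g(x₀) < 3^{-(s+1)}` — following the printed route with
  `a = 4/2^{⌊(s+1)/D⌋}` (a natural exponent; `(a/4)^D ≥ 2^{-(s+1)}` is all that is used) and the crude
  constants `log(8/7) ≥ 1/8`, `log(4/3) ≥ 1/4`, `log(7/2) ≤ 5/2`, `log 2 ≥ 1/2`.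

## Not here
The limits (files `Lemma3Limit.lean`, `Lemma3Ratio.lean`). Cell zeta5-irr (rung F-Z1): nothing here bears on
`ζ(5)`.
-/

noncomputable section

open Finset Filter Set

open scoped Nat Topology

namespace Literature.NumberTheory.Irrationality.FischlerSprangZudilin2019

namespace Lemma3

/-! ### Part A: the function `f` and its logarithm -/

/-- `φ(x) = log f(x) = D(log(x+3) - log x) + (s+1)(log(x+1) - log(x+2))`.
[cite: FischlerSprangZudilin2019, §4 proof of Lemma 3 (f and f'/f)] -/
def phi (s D : ℕ) (x : ℝ) : ℝ :=
  (D : ℝ) * (Real.log (x + 3) - Real.log x) + ((s : ℝ) + 1) * (Real.log (x + 1) - Real.log (x + 2))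

/-- `f(x) > 0` for `x > 0`. [cite: FischlerSprangZudilin2019, §4 proof of Lemma 3 (definition of f)] -/
theorem fRatio_pos (s D : ℕ) {x : ℝ} (hx : 0 < x) : 0 < fRatio s D x := by
  unfold fRatio; positivity

/-- `log f = φ` on `x > 0`. [cite: FischlerSprangZudilin2019, §4 proof of Lemma 3 (f'/f)] -/
theorem log_fRatio (s D : ℕ) {x : ℝ} (hx : 0 < x) : Real.log (fRatio s D x) = phi s D x := by
  unfold fRatio phi
  rw [Real.log_mul (by positivity) (by positivity), Real.log_pow, Real.log_pow,
    Real.log_div (by positivity) hx.ne', Real.log_div (by positivity) (by positivity)]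
  push_cast
  ring

/-- `f = exp ∘ φ` on `x > 0`. [cite: FischlerSprangZudilin2019, §4 proof of Lemma 3 (f'/f)] -/
theorem fRatio_eq_exp_phi (s D : ℕ) {x : ℝ} (hx : 0 < x) : fRatio s D x = Real.exp (phi s D x) := by
  rw [← log_fRatio s D hx, Real.exp_log (fRatio_pos s D hx)]

/-- The numerator `q(x) = a x² + 3a x - 6D` of `f'/f`, `a = s+1-3D` (the source's `a`, `b = 3a`, `c = -6D`).
[cite: FischlerSprangZudilin2019, §4 proof of Lemma 3 (f'/f = (ax²+bx+c)/(x(x+1)(x+2)(x+3)))] -/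
def qNum (s D : ℕ) (x : ℝ) : ℝ :=
  ((s : ℝ) + 1 - 3 * D) * x ^ 2 + 3 * ((s : ℝ) + 1 - 3 * D) * x - 6 * D

/-- **`φ'(x) = q(x)/(x(x+1)(x+2)(x+3))`** for `x > 0`. [cite: FischlerSprangZudilin2019, §4 proof of Lemma 3 (f'/f)] -/
theorem hasDerivAt_phi (s D : ℕ) {x : ℝ} (hx : 0 < x) :
    HasDerivAt (phi s D) (qNum s D x / (x * (x + 1) * (x + 2) * (x + 3))) x := by
  have h3 : HasDerivAt (fun y : ℝ => Real.log (y + 3)) (1 / (x + 3)) x :=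
    ((hasDerivAt_id x).add_const 3).log (by simp; linarith)
  have h0 : HasDerivAt (fun y : ℝ => Real.log y) (1 / x) x := by
    simpa using ((hasDerivAt_id x).log (by simp; exact hx.ne'))
  have h1 : HasDerivAt (fun y : ℝ => Real.log (y + 1)) (1 / (x + 1)) x :=
    ((hasDerivAt_id x).add_const 1).log (by simp; linarith)
  have h2 : HasDerivAt (fun y : ℝ => Real.log (y + 2)) (1 / (x + 2)) x :=
    ((hasDerivAt_id x).add_const 2).log (by simp; linarith)
  have h := ((h3.sub h0).const_mul (D : ℝ)).add ((h1.sub h2).const_mul ((s : ℝ) + 1))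
  refine (show HasDerivAt (phi s D) _ x from h).congr_deriv ?_
  unfold qNum
  field_simp
  ring

/-- `φ` is continuous at every `x > 0`. [cite: FischlerSprangZudilin2019, §4 proof of Lemma 3 (f'/f)] -/
theorem continuousOn_phi (s D : ℕ) : ContinuousOn (phi s D) (Ioi 0) :=
  fun _ hx => (hasDerivAt_phi s D hx).continuousAt.continuousWithinAt

/-- `q` is strictly increasing on `[0, ∞)` (`a = s+1-3D ≥ 1`). [cite: FischlerSprangZudilin2019, §4 proof of Lemma 3 (a > 0, c < 0)] -/
theorem qNum_lt_qNum {s D : ℕ} (h3D : 3 * D ≤ s) {x y : ℝ} (hx : 0 ≤ x) (hxy : x < y) :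
    qNum s D x < qNum s D y := by
  have ha : (1 : ℝ) ≤ (s : ℝ) + 1 - 3 * D := by
    have : (3 * D : ℝ) ≤ s := by exact_mod_cast h3D
    linarith
  unfold qNum
  have h1 : x ^ 2 < y ^ 2 := by nlinarith
  nlinarith

/-- **The critical point `x₁`**: the unique positive zero of `q` (so of `f'`), with `q < 0` before and `q > 0`
after it. [cite: FischlerSprangZudilin2019, §4 proof of Lemma 3 ("vanishes exactly at one positive real number x₁")] -/
theorem exists_critical {s D : ℕ} (hD : 1 ≤ D) (h3D : 3 * D ≤ s) :
    ∃ x₁ : ℝ, 0 < x₁ ∧ qNum s D x₁ = 0 ∧ (∀ x, 0 ≤ x → x < x₁ → qNum s D x < 0) ∧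
      (∀ x, x₁ < x → 0 < qNum s D x) := by
  have hD' : (1 : ℝ) ≤ D := by exact_mod_cast hD
  have ha : (1 : ℝ) ≤ (s : ℝ) + 1 - 3 * D := by
    have : (3 * D : ℝ) ≤ s := by exact_mod_cast h3D
    linarith
  have hq0 : qNum s D 0 < 0 := by unfold qNum; nlinarith
  have hqB : 0 < qNum s D (6 * D) := by unfold qNum; nlinarith
  have hcont : ContinuousOn (qNum s D) (Icc 0 (6 * D)) := by
    unfold qNum; fun_prop
  obtain ⟨x₁, hx₁, hq⟩ := intermediate_value_Ioo (by positivity) hcont ⟨hq0, hqB⟩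
  refine ⟨x₁, hx₁.1, hq, fun x hx hlt => ?_, fun x hlt => ?_⟩
  · have := qNum_lt_qNum h3D hx hlt
    linarith
  · have := qNum_lt_qNum h3D hx₁.1.le hlt
    linarith

/-- **`f(x) → 1` as `x → +∞`**. [cite: FischlerSprangZudilin2019, §4 proof of Lemma 3 ("lim_{x→+∞} f(x) = 1")] -/
theorem tendsto_fRatio_atTop (s D : ℕ) : Tendsto (fRatio s D) atTop (𝓝 1) := by
  have h1 : Tendsto (fun x : ℝ => (x + 3) / x) atTop (𝓝 1) := by
    have h : Tendsto (fun x : ℝ => 1 + 3 / x) atTop (𝓝 (1 + 0)) :=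
      tendsto_const_nhds.add (tendsto_const_nhds.div_atTop tendsto_id)
    rw [add_zero] at h
    refine h.congr' ?_
    filter_upwards [eventually_gt_atTop 0] with x hx
    field_simp
  have h2 : Tendsto (fun x : ℝ => (x + 1) / (x + 2)) atTop (𝓝 1) := by
    have h : Tendsto (fun x : ℝ => 1 - 1 / (x + 2)) atTop (𝓝 (1 - 0)) :=
      tendsto_const_nhds.sub (tendsto_const_nhds.div_atTop
        (tendsto_atTop_add_const_right _ _ tendsto_id))
    rw [sub_zero] at h
    refine h.congr' ?_
    filter_upwards [eventually_gt_atTop 0] with x hx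
    field_simp
    ring
  have h := (h1.pow D).mul (h2.pow (s + 1))
  rw [one_pow, one_pow, one_mul] at h
  exact h

/-- `f(3/2^{s+2}) > 1` (an explicit point of `(0, x₀)`; the source's "`lim_{x→0⁺} f(x) = +∞`").
[cite: FischlerSprangZudilin2019, §4 proof of Lemma 3 ("lim_{x→0⁺} f(x) = +∞")] -/
theorem one_lt_fRatio_small {s D : ℕ} (hD : 1 ≤ D) : 1 < fRatio s D (3 / 2 ^ (s + 2)) := by
  set x : ℝ := 3 / 2 ^ (s + 2) with hx_def
  have hx : 0 < x := by positivity
  have hA : (2 : ℝ) ^ (s + 2) ≤ (x + 3) / x := by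
    rw [le_div_iff₀ hx, hx_def]
    have h2 : (0 : ℝ) < 2 ^ (s + 2) := by positivity
    field_simp
    nlinarith
  have hA1 : (1 : ℝ) ≤ (x + 3) / x := le_trans (one_le_pow₀ (by norm_num)) hA
  have hAD : (2 : ℝ) ^ (s + 2) ≤ ((x + 3) / x) ^ D :=
    hA.trans (le_self_pow₀ hA1 (by omega))
  have hB : (1 / 2 : ℝ) ≤ (x + 1) / (x + 2) := by
    rw [le_div_iff₀ (by positivity)]
    linarith
  have hBs : (1 / 2 : ℝ) ^ (s + 1) ≤ ((x + 1) / (x + 2)) ^ (s + 1) :=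
    pow_le_pow_left₀ (by norm_num) hB _
  have h2 : (2 : ℝ) = 2 ^ (s + 2) * (1 / 2) ^ (s + 1) := by
    rw [one_div_pow]
    field_simp
    ring
  unfold fRatio
  calc (1 : ℝ) < 2 := by norm_num
    _ = 2 ^ (s + 2) * (1 / 2) ^ (s + 1) := h2
    _ ≤ ((x + 3) / x) ^ D * ((x + 1) / (x + 2)) ^ (s + 1) :=
        mul_le_mul hAD hBs (by positivity) (by positivity)

/-- **The root `x₀`** (existence, and the sign structure which gives uniqueness): there is `x₀ > 0` with
`f(x₀) = 1`, `f > 1` on `(0, x₀)` and `f < 1` on `(x₀, ∞)`.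
[cite: FischlerSprangZudilin2019, §4 proof of Lemma 3 ("there exists a unique positive real number x₀ such that f(x₀) = 1")] -/
theorem exists_root {s D : ℕ} (hD : 1 ≤ D) (h3D : 3 * D ≤ s) :
    ∃ x₀ : ℝ, 0 < x₀ ∧ fRatio s D x₀ = 1 ∧ (∀ x, 0 < x → x < x₀ → 1 < fRatio s D x) ∧
      (∀ x, x₀ < x → fRatio s D x < 1) := by
  obtain ⟨x₁, hx₁, -, hneg, hpos⟩ := exists_critical hD h3D
  -- φ is strictly decreasing on (0, x₁] and strictly increasing on [x₁, ∞)
  have hderiv : ∀ x, 0 < x → deriv (phi s D) x = qNum s D x / (x * (x + 1) * (x + 2) * (x + 3)) :=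
    fun x hx => (hasDerivAt_phi s D hx).deriv
  have hanti : StrictAntiOn (phi s D) (Ioc 0 x₁) := by
    refine strictAntiOn_of_deriv_neg (convex_Ioc 0 x₁)
      ((continuousOn_phi s D).mono fun x hx => hx.1) fun x hx => ?_
    rw [interior_Ioc] at hx
    rw [hderiv x hx.1]
    exact div_neg_of_neg_of_pos (hneg x hx.1.le hx.2) (by have := hx.1; positivity)
  have hmono : StrictMonoOn (phi s D) (Ici x₁) := by
    refine strictMonoOn_of_deriv_pos (convex_Ici x₁)
      ((continuousOn_phi s D).mono fun x hx => hx₁.trans_le hx) fun x hx => ?_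
    rw [interior_Ici] at hx
    rw [hderiv x (hx₁.trans hx)]
    exact div_pos (hpos x hx) (by have := hx₁.trans hx; positivity)
  -- φ < 0 on [x₁, ∞), from f → 1
  have hphi_neg : ∀ x, x₁ ≤ x → phi s D x < 0 := by
    intro x hx
    by_contra hcon
    push Not at hcon
    have hc : 0 < phi s D (x + 1) := lt_of_le_of_lt hcon (hmono hx (by simp; linarith) (by linarith))
    have hev : ∀ᶠ y in atTop, fRatio s D y < Real.exp (phi s D (x + 1)) :=
      (tendsto_fRatio_atTop s D).eventually (eventually_lt_nhds (Real.one_lt_exp_iff.2 hc))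
    obtain ⟨y, hy1, hy2⟩ := (hev.and (eventually_ge_atTop (x + 1))).exists
    have hy0 : 0 < y := by linarith [hx₁]
    have hle : phi s D (x + 1) ≤ phi s D y := hmono.monotoneOn (by simp; linarith) (by simp; linarith) hy2
    rw [fRatio_eq_exp_phi s D hy0, Real.exp_lt_exp] at hy1
    linarith
  -- the explicit point where f > 1 lies in (0, x₁)
  set xs : ℝ := 3 / 2 ^ (s + 2) with hxs
  have hxs0 : 0 < xs := by positivity
  have hphis : 0 < phi s D xs := by
    rw [← log_fRatio s D hxs0]
    exact Real.log_pos (one_lt_fRatio_small hD)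
  have hxs1 : xs < x₁ := by
    by_contra hcon
    push Not at hcon
    linarith [hphi_neg xs hcon]
  -- IVT on [xs, x₁]
  have hcont : ContinuousOn (phi s D) (Icc xs x₁) :=
    (continuousOn_phi s D).mono fun x hx => hxs0.trans_le hx.1
  obtain ⟨x₀, hx₀, hroot⟩ := intermediate_value_Ioo' hxs1.le hcont ⟨hphi_neg x₁ le_rfl, hphis⟩
  have hx₀0 : 0 < x₀ := hxs0.trans hx₀.1
  refine ⟨x₀, hx₀0, ?_, fun x hx hlt => ?_, fun x hlt => ?_⟩
  · rw [fRatio_eq_exp_phi s D hx₀0, hroot, Real.exp_zero]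
  · rw [fRatio_eq_exp_phi s D hx, ← Real.exp_zero, Real.exp_lt_exp, ← hroot]
    exact hanti ⟨hx, (hlt.trans hx₀.2).le⟩ ⟨hx₀0, hx₀.2.le⟩ hlt
  · have hx : 0 < x := hx₀0.trans hlt
    rw [fRatio_eq_exp_phi s D hx, ← Real.exp_zero, Real.exp_lt_exp]
    rcases le_or_gt x x₁ with h | h
    · rw [← hroot]
      exact hanti ⟨hx₀0, hx₀.2.le⟩ ⟨hx, h⟩ hlt
    · exact hphi_neg x h.le

/-- Uniqueness of the positive solution of `f(x) = 1` from the sign structure.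
[cite: FischlerSprangZudilin2019, §4 Lemma 3 ("x₀ is the unique positive root")] -/
theorem root_unique {s D : ℕ} {x₀ : ℝ} (hlt : ∀ x, 0 < x → x < x₀ → 1 < fRatio s D x)
    (hgt : ∀ x, x₀ < x → fRatio s D x < 1) {x : ℝ} (hx : 0 < x) (h : fRatio s D x = 1) : x = x₀ := by
  rcases lt_trichotomy x x₀ with h1 | h1 | h1
  · exact absurd h (hlt x hx h1).ne'
  · exact h1
  · exact absurd h (hgt x h1).ne

/-! ### Part B: the profile `L` -/

/-- `g(x) > 0` for `x > -1` (in particular `x ≥ 0`); here for `x > 0` and `D ≥ 1`.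
[cite: FischlerSprangZudilin2019, §4 Lemma 3 eq. (4.2) (definition of g)] -/
theorem gRate_pos {s D : ℕ} (hD : 1 ≤ D) {x : ℝ} (hx : 0 ≤ x) : 0 < gRate s D x := by
  have : (0 : ℝ) < D := by exact_mod_cast hD
  unfold gRate; positivity

/-- `log g(x) = 3D log D + 3D log(x+3) + (s+1) log(x+1) - 2(s+1) log(x+2)` (`x ≥ 0`, `D ≥ 1`).
[cite: FischlerSprangZudilin2019, §4 proof of Lemma 3 ("log g(x₀) ≤ 3D log D + 3D log(7/2) + (s+1)(…)")] -/
theorem log_gRate {s D : ℕ} (hD : 1 ≤ D) {x : ℝ} (hx : 0 ≤ x) :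
    Real.log (gRate s D x) = 3 * D * Real.log D + 3 * D * Real.log (x + 3) +
      ((s : ℝ) + 1) * Real.log (x + 1) - 2 * ((s : ℝ) + 1) * Real.log (x + 2) := by
  have hD0 : (0 : ℝ) < D := by exact_mod_cast hD
  unfold gRate
  rw [Real.log_div (by positivity) (by positivity), Real.log_mul (by positivity) (by positivity),
    Real.log_mul (by positivity) (by positivity), Real.log_pow, Real.log_pow, Real.log_pow, Real.log_pow]
  push_cast
  ring

/-- **`L(x) = log g(x) + x log f(x)`** for `x > 0` (so `e^{L(x₀)} = g(x₀) f(x₀)^{x₀} = g(x₀)`).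
[cite: FischlerSprangZudilin2019, §4 proof of Lemma 3, eq. (4.4)] -/
theorem Lprof_eq {s D : ℕ} (hD : 1 ≤ D) {x : ℝ} (hx : 0 < x) :
    Lprof s D x = Real.log (gRate s D x) + x * Real.log (fRatio s D x) := by
  have hD0 : (0 : ℝ) < D := by exact_mod_cast hD
  have e1 : Real.log ((D : ℝ) * x + 3 * D) = Real.log D + Real.log (x + 3) := by
    rw [show (D : ℝ) * x + 3 * D = D * (x + 3) by ring, Real.log_mul hD0.ne' (by linarith)]
  have e2 : Real.log ((D : ℝ) * x) = Real.log D + Real.log x := Real.log_mul hD0.ne' hx.ne'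
  rw [log_gRate hD hx.le, log_fRatio s D hx]
  unfold Lprof F phi
  rw [e1, e2]
  ring

/-- `L(x₀) = log g(x₀)` at the root. [cite: FischlerSprangZudilin2019, §4 proof of Lemma 3, eq. (4.4) ("= g(x₀) f(x₀)^{x₀} = g(x₀)")] -/
theorem Lprof_root {s D : ℕ} (hD : 1 ≤ D) {x₀ : ℝ} (hx₀ : 0 < x₀) (hroot : fRatio s D x₀ = 1) :
    Lprof s D x₀ = Real.log (gRate s D x₀) := by
  rw [Lprof_eq hD hx₀, hroot, Real.log_one, mul_zero, add_zero]

/-- **`L'(x) = log f(x)`** for `x > 0`. [cite: FischlerSprangZudilin2019, §4 proof of Lemma 3 (the terms with k close to x₀n dominate)] -/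
theorem hasDerivAt_Lprof {s D : ℕ} (hD : 1 ≤ D) {x : ℝ} (hx : 0 < x) :
    HasDerivAt (Lprof s D) (Real.log (fRatio s D x)) x := by
  have hD0 : (0 : ℝ) < D := by exact_mod_cast hD
  have h1 : HasDerivAt (fun y : ℝ => F ((D : ℝ) * y + 3 * D)) (Real.log ((D : ℝ) * x + 3 * D) * D) x := by
    have := (hasDerivAt_F (t := (D : ℝ) * x + 3 * D) (by positivity)).comp x
      (((hasDerivAt_id x).const_mul (D : ℝ)).add_const (3 * (D : ℝ)))
    simpa [Function.comp_def] using this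
  have h2 : HasDerivAt (fun y : ℝ => F ((D : ℝ) * y)) (Real.log ((D : ℝ) * x) * D) x := by
    have := (hasDerivAt_F (t := (D : ℝ) * x) (by positivity)).comp x ((hasDerivAt_id x).const_mul (D : ℝ))
    simpa [Function.comp_def] using this
  have h3 : HasDerivAt (fun y : ℝ => F (y + 2)) (Real.log (x + 2)) x := by
    have := (hasDerivAt_F (t := x + 2) (by positivity)).comp x ((hasDerivAt_id x).add_const 2)
    simpa [Function.comp_def] using this
  have h4 : HasDerivAt (fun y : ℝ => F (y + 1)) (Real.log (x + 1)) x := by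
    have := (hasDerivAt_F (t := x + 1) (by positivity)).comp x ((hasDerivAt_id x).add_const 1)
    simpa [Function.comp_def] using this
  have h := ((h1.sub h2).sub (((h3.sub h4).const_mul ((s : ℝ) + 1)))).sub_const ((s : ℝ) + 1 - 3 * D)
  have e1 : Real.log ((D : ℝ) * x + 3 * D) = Real.log D + Real.log (x + 3) := by
    rw [show (D : ℝ) * x + 3 * D = D * (x + 3) by ring, Real.log_mul hD0.ne' (by linarith)]
  have e2 : Real.log ((D : ℝ) * x) = Real.log D + Real.log x := Real.log_mul hD0.ne' hx.ne'
  refine (show HasDerivAt (Lprof s D) _ x from h).congr_deriv ?_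
  rw [log_fRatio s D hx, e1, e2]
  unfold phi
  ring

/-- `L` is continuous. [cite: FischlerSprangZudilin2019, §4 proof of Lemma 3 (eq. (4.4))] -/
theorem continuous_Lprof (s D : ℕ) : Continuous (Lprof s D) := by
  have h1 : Continuous fun x : ℝ => F ((D : ℝ) * x + 3 * D) := continuous_F.comp (by fun_prop)
  have h2 : Continuous fun x : ℝ => F ((D : ℝ) * x) := continuous_F.comp (by fun_prop)
  have h3 : Continuous fun x : ℝ => F (x + 2) := continuous_F.comp (by fun_prop)
  have h4 : Continuous fun x : ℝ => F (x + 1) := continuous_F.comp (by fun_prop)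
  exact ((h1.sub h2).sub (continuous_const.mul (h3.sub h4))).sub continuous_const

/-- **`L` is strictly increasing on `[0, x₀]`** (there `f > 1`).
[cite: FischlerSprangZudilin2019, §4 proof of Lemma 3 ("f(x) ≥ 1/b(ε) for any x ∈ (0, x₀-ε]")] -/
theorem Lprof_strictMonoOn {s D : ℕ} (hD : 1 ≤ D) {x₀ : ℝ}
    (hlt : ∀ x, 0 < x → x < x₀ → 1 < fRatio s D x) : StrictMonoOn (Lprof s D) (Icc 0 x₀) := by
  refine strictMonoOn_of_deriv_pos (convex_Icc 0 x₀) (continuous_Lprof s D).continuousOn fun x hx => ?_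
  rw [interior_Icc] at hx
  rw [(hasDerivAt_Lprof hD hx.1).deriv]
  exact Real.log_pos (hlt x hx.1 hx.2)

/-- **`L` is strictly decreasing on `[x₀, ∞)`** (there `f < 1`).
[cite: FischlerSprangZudilin2019, §4 proof of Lemma 3 ("f(x) ≤ b(ε) for any x ∈ [x₀+ε, A(ε)]")] -/
theorem Lprof_strictAntiOn {s D : ℕ} (hD : 1 ≤ D) {x₀ : ℝ} (hx₀ : 0 < x₀)
    (hgt : ∀ x, x₀ < x → fRatio s D x < 1) : StrictAntiOn (Lprof s D) (Ici x₀) := by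
  refine strictAntiOn_of_deriv_neg (convex_Ici x₀) (continuous_Lprof s D).continuousOn fun x hx => ?_
  rw [interior_Ici] at hx
  have hx' : 0 < x := hx₀.trans hx
  rw [(hasDerivAt_Lprof hD hx').deriv]
  exact Real.log_neg (fRatio_pos s D hx') (hgt x hx)

/-- `L(x) ≤ L(x₀)` for every `x ≥ 0`. [cite: FischlerSprangZudilin2019, §4 proof of Lemma 3 (the terms with k close to x₀n dominate)] -/
theorem Lprof_le_root {s D : ℕ} (hD : 1 ≤ D) {x₀ : ℝ} (hx₀ : 0 < x₀)
    (hlt : ∀ x, 0 < x → x < x₀ → 1 < fRatio s D x) (hgt : ∀ x, x₀ < x → fRatio s D x < 1)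
    {x : ℝ} (hx : 0 ≤ x) : Lprof s D x ≤ Lprof s D x₀ := by
  rcases le_or_gt x x₀ with h | h
  · exact (Lprof_strictMonoOn hD hlt).monotoneOn ⟨hx, h⟩ ⟨hx₀.le, le_rfl⟩ h
  · exact (Lprof_strictAntiOn hD hx₀ hgt).antitoneOn (self_mem_Ici) (mem_Ici.2 h.le) h.le

/-- **Strict gap away from `x₀`**: for `0 < δ ≤ x₀` there is `η > 0` with `L(x) ≤ L(x₀) - η` whenever
`x ≥ 0` and `|x - x₀| ≥ δ`. [cite: FischlerSprangZudilin2019, §4 proof of Lemma 3, eqs. (4.5)–(4.7)] -/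
theorem Lprof_gap {s D : ℕ} (hD : 1 ≤ D) {x₀ : ℝ} (hx₀ : 0 < x₀)
    (hlt : ∀ x, 0 < x → x < x₀ → 1 < fRatio s D x) (hgt : ∀ x, x₀ < x → fRatio s D x < 1)
    {δ : ℝ} (hδ : 0 < δ) (hδx : δ ≤ x₀) :
    ∃ η : ℝ, 0 < η ∧ η ≤ 1 ∧ ∀ x : ℝ, 0 ≤ x → δ ≤ |x - x₀| → Lprof s D x ≤ Lprof s D x₀ - η := by
  have hM := Lprof_strictMonoOn hD hlt
  have hA := Lprof_strictAntiOn hD hx₀ hgt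
  have h1 : Lprof s D (x₀ - δ) < Lprof s D x₀ := hM ⟨by linarith, by linarith⟩ ⟨hx₀.le, le_rfl⟩ (by linarith)
  have h2 : Lprof s D (x₀ + δ) < Lprof s D x₀ := hA self_mem_Ici (mem_Ici.2 (by linarith)) (by linarith)
  refine ⟨min 1 (min (Lprof s D x₀ - Lprof s D (x₀ - δ)) (Lprof s D x₀ - Lprof s D (x₀ + δ))),
    lt_min one_pos (lt_min (by linarith) (by linarith)), min_le_left _ _, fun x hx hdist => ?_⟩
  rcases le_or_gt x x₀ with h | h
  · rw [abs_of_nonpos (by linarith)] at hdist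
    have : Lprof s D x ≤ Lprof s D (x₀ - δ) := hM.monotoneOn ⟨hx, h⟩ ⟨by linarith, by linarith⟩ (by linarith)
    have hm := (min_le_right (1 : ℝ) _).trans (min_le_left (Lprof s D x₀ - Lprof s D (x₀ - δ))
      (Lprof s D x₀ - Lprof s D (x₀ + δ)))
    linarith
  · rw [abs_of_pos (by linarith)] at hdist
    have : Lprof s D x ≤ Lprof s D (x₀ + δ) :=
      hA.antitoneOn (mem_Ici.2 (by linarith)) (mem_Ici.2 (by linarith)) (by linarith)
    have hm := (min_le_right (1 : ℝ) _).trans (min_le_right (Lprof s D x₀ - Lprof s D (x₀ - δ))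
      (Lprof s D x₀ - Lprof s D (x₀ + δ)))
    linarith

/-! ### Part E: the bound `g(x₀) < 3^{-(s+1)}` -/

/-- `(x+1)/(x+2) ≤ (1 + x/2)/2` for `x ≥ 0`. [cite: FischlerSprangZudilin2019, §4 proof of Lemma 3 ("(x+1)/(x+2) ≤ ½(1+x/2)")] -/
theorem ratio_le_half {x : ℝ} (hx : 0 ≤ x) : (x + 1) / (x + 2) ≤ (1 + x / 2) / 2 := by
  rw [div_le_div_iff₀ (by linarith) (by norm_num)]
  nlinarith

/-- `16(q+1) ≤ 2^q` for `q ≥ 7`. [cite: FischlerSprangZudilin2019, §4 proof of Lemma 3 ("As s/D is large")] -/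
theorem sixteen_mul_le_two_pow {q : ℕ} (hq : 7 ≤ q) : 16 * ((q : ℝ) + 1) ≤ 2 ^ q := by
  have key : ∀ m : ℕ, 16 * ((m + 7 : ℕ) + 1) ≤ 2 ^ (m + 7) := by
    intro m
    induction m with
    | zero => norm_num
    | succ m ih =>
      rw [show m + 1 + 7 = (m + 7) + 1 by ring, pow_succ]
      have : 16 ≤ 2 ^ (m + 7) :=
        calc 16 = 2 ^ 4 := by norm_num
          _ ≤ 2 ^ (m + 7) := Nat.pow_le_pow_right (by norm_num) (by omega)
      omega
  obtain ⟨m, rfl⟩ := Nat.exists_eq_add_of_le' hq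
  exact_mod_cast key m

/-- **`f(a) < 1` at `a = 4/2^{⌊(s+1)/D⌋}`**, for `D ≥ 1`, `(s+1)/D ≥ 7`.
[cite: FischlerSprangZudilin2019, §4 proof of Lemma 3 ("f(a) ≤ (7/8)^D (1+a/2)^{s+1} … < 1")] -/
theorem fRatio_a_lt_one {s D : ℕ} (hD : 1 ≤ D) (hq : 7 ≤ (s + 1) / D) :
    fRatio s D (4 / 2 ^ ((s + 1) / D)) < 1 := by
  set q : ℕ := (s + 1) / D with hq_def
  set a : ℝ := 4 / 2 ^ q with ha_def
  have h2q : (0 : ℝ) < 2 ^ q := by positivity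
  have ha0 : 0 < a := by positivity
  have h128 : (128 : ℝ) ≤ 2 ^ q := by
    calc (128 : ℝ) = 2 ^ 7 := by norm_num
      _ ≤ 2 ^ q := pow_le_pow_right₀ (by norm_num) hq
  have ha_half : a ≤ 1 / 2 := by
    rw [ha_def, div_le_div_iff₀ h2q (by norm_num)]
    linarith
  -- (a/4)^D ≥ 2^{-(s+1)}
  have hqD : q * D ≤ s + 1 := Nat.div_mul_le_self (s + 1) D
  have hpow : ((1 : ℝ) / 2) ^ (s + 1) ≤ (a / 4) ^ D := by
    have e : a / 4 = (1 / 2) ^ q := by rw [ha_def]; field_simp; rw [one_div_pow]; field_simp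
    rw [e, ← pow_mul]
    exact pow_le_pow_of_le_one (by norm_num) (by norm_num) hqD
  -- f(a) ≤ ((a+3)/a)^D (a/4)^D (1+a/2)^{s+1}
  have hB : ((a + 1) / (a + 2)) ^ (s + 1) ≤ ((1 + a / 2) / 2) ^ (s + 1) :=
    pow_le_pow_left₀ (by positivity) (ratio_le_half ha0.le) _
  have hB' : ((1 + a / 2) / 2) ^ (s + 1) = (1 / 2) ^ (s + 1) * (1 + a / 2) ^ (s + 1) := by
    rw [← mul_pow]; congr 1; ring
  have hstep1 : fRatio s D a ≤ ((a + 3) / a) ^ D * ((a / 4) ^ D * (1 + a / 2) ^ (s + 1)) := by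
    unfold fRatio
    calc ((a + 3) / a) ^ D * ((a + 1) / (a + 2)) ^ (s + 1)
        ≤ ((a + 3) / a) ^ D * ((1 / 2) ^ (s + 1) * (1 + a / 2) ^ (s + 1)) := by
          rw [← hB']; exact mul_le_mul_of_nonneg_left hB (by positivity)
      _ ≤ ((a + 3) / a) ^ D * ((a / 4) ^ D * (1 + a / 2) ^ (s + 1)) :=
          mul_le_mul_of_nonneg_left (mul_le_mul_of_nonneg_right hpow (by positivity)) (by positivity)
  have hstep2 : ((a + 3) / a) ^ D * ((a / 4) ^ D * (1 + a / 2) ^ (s + 1)) =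
      ((a + 3) / 4) ^ D * (1 + a / 2) ^ (s + 1) := by
    rw [← mul_assoc, ← mul_pow]
    congr 2
    field_simp
  have h78 : ((a + 3) / 4) ^ D ≤ (7 / 8 : ℝ) ^ D :=
    pow_le_pow_left₀ (by positivity) (by linarith) _
  -- (7/8)^D ≤ exp(-D/8), (1+a/2)^{s+1} ≤ exp((s+1) a/2)
  have h78e : (7 / 8 : ℝ) ^ D ≤ Real.exp (-(D : ℝ) / 8) := by
    have h1 : (7 / 8 : ℝ) ≤ Real.exp (-1 / 8) := by
      have := Real.add_one_le_exp (-1 / 8 : ℝ)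
      linarith
    calc (7 / 8 : ℝ) ^ D ≤ Real.exp (-1 / 8) ^ D := pow_le_pow_left₀ (by norm_num) h1 _
      _ = Real.exp (-(D : ℝ) / 8) := by rw [← Real.exp_nat_mul]; congr 1; ring
  have hae : (1 + a / 2) ^ (s + 1) ≤ Real.exp (((s : ℝ) + 1) * (a / 2)) := by
    have h1 : 1 + a / 2 ≤ Real.exp (a / 2) := by
      have := Real.add_one_le_exp (a / 2)
      linarith
    calc (1 + a / 2) ^ (s + 1) ≤ Real.exp (a / 2) ^ (s + 1) := pow_le_pow_left₀ (by positivity) h1 _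
      _ = Real.exp (((s : ℝ) + 1) * (a / 2)) := by rw [← Real.exp_nat_mul]; push_cast; ring_nf
  -- the exponent is negative: (s+1) a/2 < D/8, i.e. 16 (s+1) < D 2^q
  have hlt : ((s : ℝ) + 1) * (a / 2) - (D : ℝ) / 8 < 0 := by
    have hs1 : ((s : ℝ) + 1) < ((q : ℝ) + 1) * D := by
      have : s + 1 < (q + 1) * D := by
        rw [add_mul, one_mul]
        exact Nat.lt_div_mul_add hD
      exact_mod_cast this
    have h16 := sixteen_mul_le_two_pow hq
    have hD' : (0 : ℝ) < D := by exact_mod_cast hD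
    rw [ha_def]
    have e : ((s : ℝ) + 1) * (4 / 2 ^ q / 2) - (D : ℝ) / 8 = (16 * ((s : ℝ) + 1) - D * 2 ^ q) / (8 * 2 ^ q) := by
      field_simp
      ring
    rw [e, div_neg_iff]
    right
    refine ⟨?_, by positivity⟩
    have : 16 * ((s : ℝ) + 1) < 16 * (((q : ℝ) + 1) * D) := by linarith
    have : 16 * (((q : ℝ) + 1) * D) ≤ 2 ^ q * D := by nlinarith
    linarith
  calc fRatio s D a ≤ ((a + 3) / 4) ^ D * (1 + a / 2) ^ (s + 1) := hstep1.trans hstep2.le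
    _ ≤ (7 / 8 : ℝ) ^ D * (1 + a / 2) ^ (s + 1) := mul_le_mul_of_nonneg_right h78 (by positivity)
    _ ≤ Real.exp (-(D : ℝ) / 8) * Real.exp (((s : ℝ) + 1) * (a / 2)) :=
        mul_le_mul h78e hae (by positivity) (by positivity)
    _ = Real.exp (((s : ℝ) + 1) * (a / 2) - (D : ℝ) / 8) := by rw [← Real.exp_add]; congr 1; ring
    _ < 1 := Real.exp_lt_one_iff.2 hlt

/-- **The bound `g(x₀) < 3^{-(s+1)}`** for `D ≥ 2`, `3D ≤ s`, `100 · D log D ≤ s` (the explicit reading of the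
hypothesis "`s/(D log D)` is sufficiently large" of Lemma 3; it implies `s ≥ 50D`), at the root `x₀` (`f(x₀) = 1`,
`f > 1` before it).
[cite: FischlerSprangZudilin2019, §4 proof of Lemma 3 ("log g(x₀) ≤ 3D log D + 3D log(7/2) + (s+1)(log(a+1) - 2log(a+2)) … < -(s+1) log 3")] -/
theorem gRate_root_lt {s D : ℕ} (hD : 2 ≤ D) (hC : 100 * ((D : ℝ) * Real.log D) ≤ s)
    {x₀ : ℝ} (hx₀ : 0 < x₀) (hroot : fRatio s D x₀ = 1) (hlt : ∀ x, 0 < x → x < x₀ → 1 < fRatio s D x) :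
    gRate s D x₀ < 1 / (3 : ℝ) ^ (s + 1) := by
  have hD1 : 1 ≤ D := le_trans (by norm_num) hD
  have hD' : (2 : ℝ) ≤ D := by exact_mod_cast hD
  have hlog2 : (1 : ℝ) / 2 < Real.log 2 := by have := Real.log_two_gt_d9; linarith
  have hlogD : (1 : ℝ) / 2 < Real.log D := hlog2.trans_le (Real.log_le_log two_pos hD')
  -- s ≥ 50 D, hence q = ⌊(s+1)/D⌋ ≥ 50 ≥ 7
  have hs50 : 50 * (D : ℝ) ≤ s := by nlinarith
  have hq : 7 ≤ (s + 1) / D := by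
    rw [Nat.le_div_iff_mul_le (by omega)]
    have : (7 * D : ℝ) ≤ s + 1 := by linarith
    exact_mod_cast this
  set q : ℕ := (s + 1) / D with hq_def
  set a : ℝ := 4 / 2 ^ q with ha_def
  have h2q : (0 : ℝ) < 2 ^ q := by positivity
  have h128 : (128 : ℝ) ≤ 2 ^ q := by
    calc (128 : ℝ) = 2 ^ 7 := by norm_num
      _ ≤ 2 ^ q := pow_le_pow_right₀ (by norm_num) hq
  have ha32 : a ≤ 1 / 32 := by
    rw [ha_def, div_le_div_iff₀ h2q (by norm_num)]
    linarith
  have ha0 : 0 < a := by positivity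
  -- x₀ < a since f(a) < 1
  have hfa : fRatio s D a < 1 := fRatio_a_lt_one hD1 hq
  have hx₀a : x₀ < a := by
    by_contra hcon
    push Not at hcon
    rcases hcon.eq_or_lt with h | h
    · rw [h, hroot] at hfa; exact lt_irrefl _ hfa
    · linarith [hlt a ha0 h]
  -- log g(x₀) ≤ 3D log D + 3D log(7/2) + (s+1)(x₀ - 2 log 2)
  have hlg := log_gRate (s := s) hD1 hx₀.le
  have h72 : Real.log (x₀ + 3) ≤ 5 / 2 := by
    have := Real.log_le_sub_one_of_pos (show (0 : ℝ) < x₀ + 3 by linarith)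
    linarith
  have hl1 : Real.log (x₀ + 1) ≤ 1 / 32 := by
    have := Real.log_le_sub_one_of_pos (show (0 : ℝ) < x₀ + 1 by linarith)
    linarith
  have hl2 : Real.log 2 ≤ Real.log (x₀ + 2) := Real.log_le_log two_pos (by linarith)
  have hlog43 : (1 : ℝ) / 4 ≤ Real.log (4 / 3) := by
    have := Real.one_sub_inv_le_log_of_pos (show (0 : ℝ) < 4 / 3 by norm_num)
    norm_num at this ⊢
    linarith
  have hlog3 : Real.log 3 = 2 * Real.log 2 - Real.log (4 / 3) := by
    rw [Real.log_div (by norm_num) (by norm_num), show (4 : ℝ) = 2 ^ 2 by norm_num, Real.log_pow]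
    push_cast
    ring
  have hs1 : (0 : ℝ) ≤ (s : ℝ) + 1 := by positivity
  have hD0 : (0 : ℝ) ≤ D := by positivity
  have hkey : Real.log (gRate s D x₀) < -(((s : ℝ) + 1) * Real.log 3) := by
    rw [hlg, hlog3]
    have p1 := mul_le_mul_of_nonneg_left h72 (by positivity : (0 : ℝ) ≤ 3 * D)
    have p2 := mul_le_mul_of_nonneg_left hl1 hs1
    have p3 := mul_le_mul_of_nonneg_left hl2 hs1
    have p4 := mul_le_mul_of_nonneg_left hlog43 hs1
    have p5 : 0 ≤ (D : ℝ) * (Real.log D - 1 / 2) := mul_nonneg hD0 (by linarith)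
    nlinarith [p1, p2, p3, p4, p5, hC, hs50, hD']
  have hg := gRate_pos (s := s) hD1 hx₀.le
  calc gRate s D x₀ = Real.exp (Real.log (gRate s D x₀)) := (Real.exp_log hg).symm
    _ < Real.exp (-(((s : ℝ) + 1) * Real.log 3)) := Real.exp_lt_exp.2 hkey
    _ = 1 / (3 : ℝ) ^ (s + 1) := by
        rw [show ((s : ℝ) + 1) * Real.log 3 = ((s + 1 : ℕ) : ℝ) * Real.log 3 by push_cast; ring,
          ← Real.log_pow, Real.exp_neg, Real.exp_log (by positivity), one_div]

end Lemma3

end Literature.NumberTheory.Irrationality.FischlerSprangZudilin2019
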